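import Summits.QuantumFields.YangMills.Theorems.UnitScaleTiltProp7ComplementaryProjectorSourceForm
import HarnessLib

/-!
# Route `UnitScaleTilt`, crux K1 «MinimiserStabilityRegPr» (stmt-QuantumFields-19200), EX row `h88` (S47), CHAIR LOCATE №41 letter **(src-κ)** —
# **THE AGMON-WEIGHTED EDITION OF P3v's SOURCE LETTER: the lifted coarse source `T c(v)` of print's complementary gauge projector
# `(1 − R)v = G_a(T c(v))` PRESERVES A BLOCK-DISTANCE WEIGHT** — for a site field `v` decaying from a block `z`,
# `‖v(x)‖ ≤ V_b·e^{−δ·tdist(B x, z)}`, the source decays at the same rate: `‖(T c(v))(x)‖ ≤ C_src,w·V_b·e^{−δ·tdist(B x, z)}`, `0 ≤ δ < min(κ, μ′)`,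
# constant K-FREE by P3v's `A_T·c₀(√c₁)⁻¹ℓ³ = 5∕2` bookkeeping (✓`Prop7ComplementaryProjectorSourceForm.norm_equiv_complementary_source_apply_le` is the `δ = 0` case).

Cell `ym3-torus` (HUMAN RULING D-0037; rung R3 = SU(2) YM₃ on T³ — NOT d = 4, NOT infinite volume, NOT a mass gap, NOT Clay).  Width seat `ym3-torus-px13` (gen 16).
THEOREMS ONLY (0 `def`, 0 `sorry`, default heartbeats); `--supports stmt-QuantumFields-19200 --as helper`; count-neutral.
WHY (CHAIR ★p1 g28 LOCATE №41, 2026-08-30T13:28:55Z).  The EX row `h88` (the value row of `Δ^η H_π` on a coarse spike) splits as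
`Δ^η(H_π ω) = [Q_k†K_π⁻¹ω − Q_k†(a•ω)] + D(R_S(G′ᴾ j))`, `j := D*_{U₀}Δ^η(H_π ω)`, so `h88 ⟸ h137kπ ∧ h133 ∧ (c4w)`, (c4w) = the Agmon-weighted GRADIENT row of
`R_S G′ᴾ` on a decaying site source.  Under Lift, ✓`RS_GprimeP_eq_RS_G` and P4 ✓`RS_G_eq_of_sourceForm` give `D R_S G′ᴾ g = D G_a(g − T c(G_a g))`, so (c4w) ⟸ {T1-κ `hDw`
(✓W4 `hDw_of_letters`), VAL-κ `hGw` (✓W1 `hGsupW_of_regPr`), **(src-κ)**} — this file is (src-κ): P3v §2–§5 re-run with the weight carried through.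
THE MATHEMATICS ([Balaban1985BackgroundPropagators] (3.21)–(3.25), Thm 3.1 (3.42)∕(3.46), (3.49); two-kernel convolution [Balaban1988RG2Cluster] (2.7)).  P3v writes
`c(v) = Σ_i λ_i(v)•b_i`, `λ_i(v) = Σ_{i′} M⁻¹_{ii′}⟪ψ_{i′}, v⟫`, `ψ_i = G_a(T(b_i))`.  (i) A spike column against a WEIGHTED field: V5's single-spike pairing
`|⟪ψ_i, δ_x⊗v(x)⟫| ≤ c₀(√c₁)⁻¹C_pt‖v(x)‖e^{−κ·dc(Bx, i)}` (✓`norm_inner_spike_column_single_le`, column decay `hcol` ⟸ V4) against `‖v(x)‖ ≤ V_b e^{−δ·dc(Bx, z)}` and the triangle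
inequality `dc(i, z) ≤ dc(Bx, i) + dc(Bx, z)` give `e^{−κ dc(Bx,i)}e^{−δ dc(Bx,z)} ≤ e^{−(κ−δ)dc(Bx,i)}·e^{−δ dc(i,z)}`, and the fine sum `Σ_x e^{−(κ−δ)dc(Bx,i)} ≤ ℓ³(2(1+1∕(κ−δ)))³`
(✓`sum_exp_neg_mul_tdist_block_coarse_le`) ⟹ `|⟪ψ_i, v⟫| ≤ c₀(√c₁)⁻¹C_pt ℓ³(2(1+1∕(κ−δ)))³·V_b·e^{−δ dc(i,z)}`.  (ii) The Gram inverse decays, `‖M⁻¹_{ii′}‖ ≤ C_N e^{−μ′ dc(i,i′)}`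
(✓B2c `norm_gram_inv_spike_le_exp_neg_tdist`, `C_N = (m_B²∕2 − 3ε(μ′)²)⁻¹e^{9μ′}`), so the same split with `dc(i,z) ≤ dc(i,i′) + dc(i′,z)` and ✓`sum_exp_neg_mul_dc_spike_le` at rate `μ′ − δ` give
`|λ_i(v)| ≤ C_N·4(2(1+1∕(μ′−δ)))³·c₀(√c₁)⁻¹C_pt ℓ³(2(1+1∕(κ−δ)))³·V_b·e^{−δ dc(i,z)}`.  (iii) The lift is block-LOCAL (✓`spike_column_source_eq_zero_off_block`): at a fine site `x` only the
four spikes of `B x` survive, each of size `A_T = (5∕4)√(2c₁)ℓ⁻³∕c₀·√(2c₁)(√c₁)⁻¹`, so `‖(T c(v))(x)‖ ≤ 4A_T·max_{jk}|λ_{(Bx,jk)}(v)|` carries the weight `e^{−δ dc(Bx, z)}` of ITS OWN block.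
`A_T·c₀(√c₁)⁻¹ℓ³ = 5∕2`: K-free for every `c₁`, as in P3v.
WHAT IS PROVED (ns `Summit.QuantumFields.YangMills.Theorems.Prop7ComplementarySourceWeighted`; P3v's letters VERBATIM: `hseq hι hT ha hAG hGA`, B2c's `hδ₁ hδ hwin hCT hCTb hCG hGn hmB hcoer
hgap` at a Gram slope `μ′ > 0`, the column letter `hcol` at rate `κ`; the weight rate `0 ≤ δ < κ`, `δ < μ′` — so `0 < κ` is implied and P3v's separate `hκ` binder is dropped).
* §1 `exp_neg_mul_split` — the two-kernel split `e^{−μ s}·e^{−δ t′} ≤ e^{−(μ−δ)s}·e^{−δ t}` for `t ≤ s + t′`, `0 ≤ δ` (pure real).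
* §2 ★ `norm_inner_spike_column_le_of_weighted` — (i): `‖⟪G(T(b_i)), v⟫‖ ≤ (c₀(√c₁)⁻¹C_pt·ℓ³(2(1+1∕(κ−δ)))³·V_b)·e^{−δ·tdist(σ i.1, z)}`.
* §3 ★ `norm_sum_mul_le_of_decay` — (ii) abstractly: a kernel `‖N i i′‖ ≤ C_N e^{−μ′ dc(i,i′)}` applied to a field `‖w i′‖ ≤ A e^{−δ dc(i′,z)}` gives `‖Σ_{i′} N i i′·w i′‖ ≤ C_N·A·4(2(1+1∕(μ′−δ)))³·e^{−δ dc(i,z)}`;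
  ★★ `norm_coeff_le_of_weighted` — the Gram coefficients `λ_i(v)` of a WEIGHTED field (B2c ∘ §2 ∘ §3).
* §4 ★ `norm_equiv_lift_coeffSum_apply_le_local` — (iii): `‖(T(Σ_i coef_i•b_i))(x)‖ ≤ 4·A_T·C` whenever `‖coef (s₀(x), jk)‖ ≤ C` for the four spikes of the block `s₀(x) = σ⁻¹(B x)` ONLY
  (P3v §4 ✓`norm_equiv_lift_coeffSum_apply_le` asks the bound for every `i`; the proof is P3v's, the hypothesis localised).
* §5 ★★★ `norm_equiv_complementary_source_apply_le_of_weighted` — **(src-κ)**: `‖(T c(v))(x)‖ ≤ C_src,w·V_b·e^{−δ·tdist(B x, z)}` with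
  `C_src,w = 4A_T·C_N·4(2(1+1∕(μ′−δ)))³·c₀(√c₁)⁻¹C_pt ℓ³(2(1+1∕(κ−δ)))³`; ★★★ `hsrcW_of_P3v` — the same as the LETTER `∀ v z V_b, (weighted in) → ∀ x, (weighted out)` in W4's fibre currency
  (`WL2.equiv … (siteEquiv F K x)`, `iterBlockOf (K − n) x`, coarse centre `z`), the `hsrc`-slot of the (c4w) knit (P4 ✓`gradient_row_of_letters` is its `δ = 0` shape).
HYP-SAT (★★OWNER RULING №42): every hypothesis is a letter of P3v∕V5∕B2c VERBATIM — `RegPr` (member class), `hseq hι hT hAG hGA` (LOD letters ⟸ ✓`exists_intertwiner_of_regPr`, ✓`exists_massive_inverse`),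
B2c's window∕gap (⟸ `window_delta`∕`window_win`, `coarseCoercivity_pos`), `hcol` (⟸ V4 ✓`norm_equiv_massiveColumn_apply_le_decay`), the weighted source bound `hv` = data (at `δ = 0` it is P3v's sup datum);
`δ` is a free rate below `min(κ, μ′)`; conclusions are explicit decayed rows — non-vacuous, no `Prop` placeholder.
HONEST SCOPE.  VALUE-class bookkeeping over landed bricks (a re-run of P3v with one exponential weight); nothing of (c4w), the h88-DOOR, T1, `hPcol`, the eight EX rows, EX `stub_existenceMinimalOrbit`,
`MinimiserStabilityRegPr` (19200) or R3 is proved here; the Yang–Mills mass gap is NOT proved.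

References: T. Bałaban, CMP **99** (1985) 389–434 [Balaban1985BackgroundPropagators] ((3.11) p.392, (3.16) p.393, (3.21)–(3.25) p.394, Thm 3.1 (3.42)∕(3.46) pp.397–398, (3.49) p.399,
(3.118)–(3.122) pp.419–420); CMP **102** (1985) 277–309 [Balaban1985Variational] ((88) p.291, (138)–(139) p.299); T. Bałaban, CMP **116** (1988) 1–22 [Balaban1988RG2Cluster] ((2.7) p.13).
-/

set_option autoImplicit false

noncomputable section

open scoped BigOperators Matrix.Norms.L2Operator InnerProductSpace ComplexConjugate Matrix

namespace Summit.QuantumFields.YangMills.Theorems.Prop7ComplementarySourceWeighted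
open Literature.MathematicalPhysics.QuantumFieldTheory.Balaban1983to89
open Finset T4Continuum BlockAveraging
open BlockAveraging (Idx)
open B7Prop1Explicit (U1 disp)
open B5Eq118OneStroke (iterBlockOf iterBlock mem_iterBlock card_iterBlock)
open B10Eq27TorusAxialLog (holT transl)
open B7TransferAnalyticMean (meanCLM)
open B4Sect5Torus (TSite)
open B9Eq311L2Pairing (WL2)
open B11Eq103H1Complex (SiteL2K BondL2K projR)
open Summit.QuantumFields.YangMills.Theorems.Prop8Chart (emlIterU)
open Literature.MathematicalPhysics.QuantumFieldTheory.Balaban1983to89.T3ContinuumYM3Torus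
open T3SectALandauChart (eta eta_pos bgUnits)
open T3PrintedRegularMinimiser (RegPr)
open T3PrintedRegularOrbits (sites_eq)
open T3LevelShift (siteShift)
open Summit.QuantumFields.YangMills.Theorems.Prop7SectET3Transport (periodsT3 siteEquiv)
open Summit.QuantumFields.YangMills.Theorems.Prop7SectET3HilbertLetters (W₂ frobEquiv toL2 toL2S DL2 DstarL2 covLapSite toL2S_apply toL2S_symm_apply inner_frobEquiv_symm)
open Summit.QuantumFields.YangMills.Theorems.Prop7SiteEntryCoordinates (orthonormal_spike top_le_span_spike)
open Summit.QuantumFields.YangMills.Theorems.Prop7BlockDistanceWeights (sum_exp_neg_mul_tdist_coarse_le tdist_coarse_comm tdist_coarse_triangle)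
open Summit.QuantumFields.YangMills.Theorems.Prop7CoarseGramInverseDecay (spike_eq_lift norm_gram_inv_spike_le_exp_neg_tdist)
open Summit.QuantumFields.YangMills.Theorems.Prop7ComplementaryProjectorBlockDecay (sum_exp_neg_mul_dc_spike_le spike_column_source_eq_zero_off_block)
open Summit.QuantumFields.YangMills.Theorems.Prop7ComplementaryProjectorPointwiseDecay (norm_spikeEntry_le norm_inner_spike_column_single_le)
open Summit.QuantumFields.YangMills.Theorems.Prop7MassiveColumnSupBound (norm_equiv_column_source_le)
open Summit.QuantumFields.YangMills.Theorems.Prop7ComplementaryProjectorSourceForm (sum_exp_neg_mul_tdist_block_coarse_le)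

variable (F : T3Family) {n K : ℕ} (h : n ≤ K) {c₀ c₁ : ℝ} [Fact (0 < c₀)] [Fact (0 < c₁)]
  {ε₀ : ℝ} (hε₀ : 0 < ε₀) (hε7 : 10 ^ 7 * (F.L : ℝ) ^ 3 * ε₀ ≤ 1)
  (U₀ : GaugeField (F.P K) 0 (Matrix.specialUnitaryGroup (Fin 2) ℂ)) (hreg : RegPr F n K ε₀ U₀)
  (Q'' : SiteL2K ℂ 3 (periodsT3 F K) c₀ W₂ →ₗ[ℂ] (Site (F.P K) (K - n) → Matrix (Fin 2) (Fin 2) ℂ))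
  (hseq : ∀ lam : Site (F.P K) 0 → Matrix (Fin 2) (Fin 2) ℂ, ∃ ns : (j : ℕ) → Site (F.P K) j → Matrix (Fin 2) (Fin 2) ℂ, ns 0 = lam ∧
      (∀ (j : ℕ) (y : Site (F.P K) (j + 1)), ns (j + 1) y = ns j (emb y) - meanCLM (Idx (F.P K)) (Matrix (Fin 2) (Fin 2) ℂ) fun i : Idx (F.P K) =>
        ns j (emb y) - ((holT (emlIterU j (bgUnits F K U₀)) (emb y) (stairWord i.2.1 (off i.1)) : (Matrix (Fin 2) (Fin 2) ℂ)ˣ) : Matrix (Fin 2) (Fin 2) ℂ) *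
          ns j (transl (emb y) (disp (stairWord i.2.1 (off i.1)))) * (((holT (emlIterU j (bgUnits F K U₀)) (emb y) (stairWord i.2.1 (off i.1)))⁻¹ : (Matrix (Fin 2) (Fin 2) ℂ)ˣ) : Matrix (Fin 2) (Fin 2) ℂ)) ∧
      ns (K - n) = Q'' (toL2S F K c₀ lam))
  (ι : (Site (F.P K) (K - n) → Matrix (Fin 2) (Fin 2) ℂ) →ₗ[ℂ] SiteL2K ℂ 3 (periodsT3 F n) c₁ W₂)
  (hι : ∀ c, ι c = toL2S F n c₁ (fun z => c (siteShift (sites_eq F n K h) z)))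
  (T : SiteL2K ℂ 3 (periodsT3 F n) c₁ W₂ →ₗ[ℂ] SiteL2K ℂ 3 (periodsT3 F K) c₀ W₂)
  (hT : ∀ (l : SiteL2K ℂ 3 (periodsT3 F K) c₀ W₂) (f : SiteL2K ℂ 3 (periodsT3 F n) c₁ W₂), ⟪ι (Q'' l), f⟫_ℂ = ⟪l, T f⟫_ℂ)
  {a : ℝ} (ha : 0 < a)
  (G : SiteL2K ℂ 3 (periodsT3 F K) c₀ W₂ →ₗ[ℂ] SiteL2K ℂ 3 (periodsT3 F K) c₀ W₂)
  (hAG : ∀ f, covLapSite F n K c₀ U₀ (G f) + (a : ℂ) • T (ι (Q'' (G f))) = f)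
  (hGA : ∀ u, G (covLapSite F n K c₀ U₀ u + (a : ℂ) • T (ι (Q'' u))) = u)

/-! ## §1 The two-kernel split -/

/-- **Two-kernel split**: for `t ≤ s + t′` and `0 ≤ δ`, `e^{−μ s}·e^{−δ t′} ≤ e^{−(μ−δ)s}·e^{−δ t}` — the weight of the far centre `z` is traded against a loss `δ` in the rate of the kernel.
[cite: Balaban1988RG2Cluster, (2.7) p.13] -/
theorem exp_neg_mul_split {μ δ s t t' : ℝ} (hδ : 0 ≤ δ) (ht : t ≤ s + t') :
    Real.exp (-(μ * s)) * Real.exp (-(δ * t')) ≤ Real.exp (-((μ - δ) * s)) * Real.exp (-(δ * t)) := by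
  rw [← Real.exp_add, ← Real.exp_add]
  refine Real.exp_le_exp.mpr ?_
  nlinarith [mul_nonneg hδ (sub_nonneg.mpr ht)]

/-! ## §2 A spike column against a WEIGHTED field -/

include hι in
/-- ★ **A SPIKE COLUMN PAIRS WITH A WEIGHTED FIELD AT THE WEIGHT OF ITS OWN BLOCK**: if `‖v(x)‖ ≤ V_b·e^{−δ·tdist(B x, z)}` and the column `ψ_i = G(T(b_i))` decays at rate `κ > δ` (`hcol`),
then `‖⟪ψ_i, v⟫‖ ≤ (c₀(√c₁)⁻¹C_pt·ℓ³(2(1+1∕(κ−δ)))³·V_b)·e^{−δ·tdist(σ i.1, z)}` — decompose `v = Σ_x toL2S(δ_x ⊗ v(x))`, V5 ✓`norm_inner_spike_column_single_le` per spike, §1, and the fine sum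
✓`sum_exp_neg_mul_tdist_block_coarse_le` at rate `κ − δ`. [cite: Balaban1985BackgroundPropagators, (3.11) p.392, Thm 3.1 (3.42) p.397; Balaban1988RG2Cluster, (2.7) p.13] -/
theorem norm_inner_spike_column_le_of_weighted {Cpt κ : ℝ} (hCpt : 0 ≤ Cpt)
    (hcol : ∀ (y : Site (F.P K) (K - n)) (Y : Matrix (Fin 2) (Fin 2) ℂ) (x : Site (F.P K) 0),
      ‖WL2.equiv ℂ _ W₂ (G (T (ι (Pi.single y Y)))) (siteEquiv F K x)‖ ≤ Cpt * Real.exp (-(κ * (Site.tdist (P := F.P K) (iterBlockOf (K - n) x) y : ℝ))) * ‖Y‖)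
    {δ : ℝ} (hδ0 : 0 ≤ δ) (hδκ : δ < κ)
    (i : Site (F.P n) 0 × (Fin 2 × Fin 2)) (v : SiteL2K ℂ 3 (periodsT3 F K) c₀ W₂) (z : Site (F.P K) (K - n)) {Vb : ℝ}
    (hv : ∀ x : Site (F.P K) 0, ‖WL2.equiv ℂ _ W₂ v (siteEquiv F K x)‖ ≤ Vb * Real.exp (-(δ * (Site.tdist (P := F.P K) (iterBlockOf (K - n) x) z : ℝ)))) :
    ‖⟪G (T ((OrthonormalBasis.mk (orthonormal_spike F) (top_le_span_spike F) : OrthonormalBasis (Site (F.P n) 0 × (Fin 2 × Fin 2)) ℂ (SiteL2K ℂ 3 (periodsT3 F n) c₁ W₂)) i)), v⟫_ℂ‖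
      ≤ (c₀ * (Real.sqrt c₁)⁻¹ * Cpt * (((((F.P K).L : ℝ) ^ (F.P K).d) ^ (K - n)) * (2 * (1 + 1 / (κ - δ))) ^ 3) * Vb)
          * Real.exp (-(δ * (Site.tdist (P := F.P K) (siteShift (sites_eq F n K h) i.1) z : ℝ))) := by
  classical
  have hc₀ : 0 < c₀ := Fact.out
  have hVb : 0 ≤ Vb := (mul_nonneg_iff_of_pos_right (Real.exp_pos _)).mp ((norm_nonneg _).trans (hv 0))
  -- decompose `v` into fine spikes
  have hdec : v = ∑ x : Site (F.P K) 0, toL2S F K c₀ (Pi.single x ((toL2S F K c₀).symm v x)) := by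
    conv_lhs => rw [← (toL2S F K c₀).apply_symm_apply v, ← Finset.univ_sum_single ((toL2S F K c₀).symm v)]
    rw [map_sum]
  have hread : ∀ x : Site (F.P K) 0, ‖(frobEquiv.symm ((toL2S F K c₀).symm v x) : W₂)‖ = ‖WL2.equiv ℂ _ W₂ v (siteEquiv F K x)‖ := fun x => by
    rw [toL2S_symm_apply, LinearEquiv.symm_apply_apply]
  rw [hdec, inner_sum]
  refine (norm_sum_le _ _).trans ?_
  have hterm : ∀ x : Site (F.P K) 0, ‖⟪G (T ((OrthonormalBasis.mk (orthonormal_spike F) (top_le_span_spike F) : OrthonormalBasis (Site (F.P n) 0 × (Fin 2 × Fin 2)) ℂ (SiteL2K ℂ 3 (periodsT3 F n) c₁ W₂)) i)), toL2S F K c₀ (Pi.single x ((toL2S F K c₀).symm v x))⟫_ℂ‖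
      ≤ (c₀ * (Real.sqrt c₁)⁻¹ * Cpt * Vb * Real.exp (-(δ * (Site.tdist (P := F.P K) (siteShift (sites_eq F n K h) i.1) z : ℝ))))
          * Real.exp (-((κ - δ) * (Site.tdist (P := F.P K) (iterBlockOf (K - n) x) (siteShift (sites_eq F n K h) i.1) : ℝ))) := by
    intro x
    refine (norm_inner_spike_column_single_le F h ι hι T G hCpt hcol i x _).trans ?_
    rw [hread x]
    have hA : 0 ≤ c₀ * (Real.sqrt c₁)⁻¹ * Cpt := by positivity
    have he : 0 ≤ Real.exp (-(κ * (Site.tdist (P := F.P K) (iterBlockOf (K - n) x) (siteShift (sites_eq F n K h) i.1) : ℝ))) := (Real.exp_pos _).le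
    -- the triangle inequality on the coarse torus
    have ht : (Site.tdist (P := F.P K) (siteShift (sites_eq F n K h) i.1) z : ℝ)
        ≤ (Site.tdist (P := F.P K) (iterBlockOf (K - n) x) (siteShift (sites_eq F n K h) i.1) : ℝ) + (Site.tdist (P := F.P K) (iterBlockOf (K - n) x) z : ℝ) := by
      rw [tdist_coarse_comm F (iterBlockOf (K - n) x) (siteShift (sites_eq F n K h) i.1)]
      exact tdist_coarse_triangle F _ _ _
    have hsplit := exp_neg_mul_split (μ := κ) hδ0 ht
    calc c₀ * (Real.sqrt c₁)⁻¹ * Cpt * ‖WL2.equiv ℂ _ W₂ v (siteEquiv F K x)‖ * Real.exp (-(κ * (Site.tdist (P := F.P K) (iterBlockOf (K - n) x) (siteShift (sites_eq F n K h) i.1) : ℝ)))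
        ≤ c₀ * (Real.sqrt c₁)⁻¹ * Cpt * (Vb * Real.exp (-(δ * (Site.tdist (P := F.P K) (iterBlockOf (K - n) x) z : ℝ)))) * Real.exp (-(κ * (Site.tdist (P := F.P K) (iterBlockOf (K - n) x) (siteShift (sites_eq F n K h) i.1) : ℝ))) :=
          mul_le_mul_of_nonneg_right (mul_le_mul_of_nonneg_left (hv x) hA) he
      _ = c₀ * (Real.sqrt c₁)⁻¹ * Cpt * Vb * (Real.exp (-(κ * (Site.tdist (P := F.P K) (iterBlockOf (K - n) x) (siteShift (sites_eq F n K h) i.1) : ℝ))) * Real.exp (-(δ * (Site.tdist (P := F.P K) (iterBlockOf (K - n) x) z : ℝ)))) := by ring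
      _ ≤ c₀ * (Real.sqrt c₁)⁻¹ * Cpt * Vb * (Real.exp (-((κ - δ) * (Site.tdist (P := F.P K) (iterBlockOf (K - n) x) (siteShift (sites_eq F n K h) i.1) : ℝ))) * Real.exp (-(δ * (Site.tdist (P := F.P K) (siteShift (sites_eq F n K h) i.1) z : ℝ)))) :=
          mul_le_mul_of_nonneg_left hsplit (by positivity)
      _ = _ := by ring
  refine (Finset.sum_le_sum fun x _ => hterm x).trans ?_
  rw [← Finset.mul_sum]
  have hS := sum_exp_neg_mul_tdist_block_coarse_le F (n := n) (sub_pos.mpr hδκ) (siteShift (sites_eq F n K h) i.1)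
  have hA : 0 ≤ c₀ * (Real.sqrt c₁)⁻¹ * Cpt * Vb * Real.exp (-(δ * (Site.tdist (P := F.P K) (siteShift (sites_eq F n K h) i.1) z : ℝ))) := by positivity
  calc (c₀ * (Real.sqrt c₁)⁻¹ * Cpt * Vb * Real.exp (-(δ * (Site.tdist (P := F.P K) (siteShift (sites_eq F n K h) i.1) z : ℝ))))
        * ∑ x : Site (F.P K) 0, Real.exp (-((κ - δ) * (Site.tdist (P := F.P K) (iterBlockOf (K - n) x) (siteShift (sites_eq F n K h) i.1) : ℝ)))
      ≤ (c₀ * (Real.sqrt c₁)⁻¹ * Cpt * Vb * Real.exp (-(δ * (Site.tdist (P := F.P K) (siteShift (sites_eq F n K h) i.1) z : ℝ))))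
        * (((((F.P K).L : ℝ) ^ (F.P K).d) ^ (K - n)) * (2 * (1 + 1 / (κ - δ))) ^ 3) := mul_le_mul_of_nonneg_left hS hA
    _ = _ := by ring

/-! ## §3 The Gram coefficients of a weighted field -/

/-- ★ **A DECAYING KERNEL ON A WEIGHTED COARSE FIELD** (two-kernel convolution, abstract): `‖N i i′‖ ≤ C_N·e^{−μ′·dc(i, i′)}` and `‖w i′‖ ≤ A·e^{−δ·dc(i′, z)}` with `0 ≤ δ < μ′` give
`‖Σ_{i′} N i i′·w i′‖ ≤ (C_N·A·4(2(1+1∕(μ′−δ)))³)·e^{−δ·dc(i, z)}` (§1 with `dc(i,z) ≤ dc(i,i′) + dc(i′,z)`, then ✓`sum_exp_neg_mul_dc_spike_le` at rate `μ′ − δ`).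
[cite: Balaban1985BackgroundPropagators, (3.49) p.399; Balaban1988RG2Cluster, (2.7) p.13] -/
theorem norm_sum_mul_le_of_decay (N : Matrix (Site (F.P n) 0 × (Fin 2 × Fin 2)) (Site (F.P n) 0 × (Fin 2 × Fin 2)) ℂ) (w : Site (F.P n) 0 × (Fin 2 × Fin 2) → ℂ)
    {CN μ' A δ : ℝ} (hCN : 0 ≤ CN) (hA : 0 ≤ A) (hδ0 : 0 ≤ δ) (hδμ : δ < μ') (z : Site (F.P K) (K - n))
    (hN : ∀ i i', ‖N i i'‖ ≤ CN * Real.exp (-(μ' * (Site.tdist (P := F.P K) (siteShift (sites_eq F n K h) i.1) (siteShift (sites_eq F n K h) i'.1) : ℝ))))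
    (hw : ∀ i', ‖w i'‖ ≤ A * Real.exp (-(δ * (Site.tdist (P := F.P K) (siteShift (sites_eq F n K h) i'.1) z : ℝ))))
    (i : Site (F.P n) 0 × (Fin 2 × Fin 2)) :
    ‖∑ i', N i i' * w i'‖ ≤ (CN * A * (4 * (2 * (1 + 1 / (μ' - δ))) ^ 3)) * Real.exp (-(δ * (Site.tdist (P := F.P K) (siteShift (sites_eq F n K h) i.1) z : ℝ))) := by
  refine (norm_sum_le _ _).trans ?_
  have hterm : ∀ i' : Site (F.P n) 0 × (Fin 2 × Fin 2), ‖N i i' * w i'‖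
      ≤ (CN * A * Real.exp (-(δ * (Site.tdist (P := F.P K) (siteShift (sites_eq F n K h) i.1) z : ℝ))))
        * Real.exp (-((μ' - δ) * (Site.tdist (P := F.P K) (siteShift (sites_eq F n K h) i.1) (siteShift (sites_eq F n K h) i'.1) : ℝ))) := by
    intro i'
    rw [norm_mul]
    have ht : (Site.tdist (P := F.P K) (siteShift (sites_eq F n K h) i.1) z : ℝ)
        ≤ (Site.tdist (P := F.P K) (siteShift (sites_eq F n K h) i.1) (siteShift (sites_eq F n K h) i'.1) : ℝ) + (Site.tdist (P := F.P K) (siteShift (sites_eq F n K h) i'.1) z : ℝ) :=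
      tdist_coarse_triangle F _ _ _
    have hsplit := exp_neg_mul_split (μ := μ') hδ0 ht
    calc ‖N i i'‖ * ‖w i'‖
        ≤ (CN * Real.exp (-(μ' * (Site.tdist (P := F.P K) (siteShift (sites_eq F n K h) i.1) (siteShift (sites_eq F n K h) i'.1) : ℝ))))
          * (A * Real.exp (-(δ * (Site.tdist (P := F.P K) (siteShift (sites_eq F n K h) i'.1) z : ℝ)))) := mul_le_mul (hN i i') (hw i') (norm_nonneg _) (by positivity)
      _ = CN * A * (Real.exp (-(μ' * (Site.tdist (P := F.P K) (siteShift (sites_eq F n K h) i.1) (siteShift (sites_eq F n K h) i'.1) : ℝ)))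
          * Real.exp (-(δ * (Site.tdist (P := F.P K) (siteShift (sites_eq F n K h) i'.1) z : ℝ)))) := by ring
      _ ≤ CN * A * (Real.exp (-((μ' - δ) * (Site.tdist (P := F.P K) (siteShift (sites_eq F n K h) i.1) (siteShift (sites_eq F n K h) i'.1) : ℝ)))
          * Real.exp (-(δ * (Site.tdist (P := F.P K) (siteShift (sites_eq F n K h) i.1) z : ℝ)))) := mul_le_mul_of_nonneg_left hsplit (by positivity)
      _ = _ := by ring
  refine (Finset.sum_le_sum fun i' _ => hterm i').trans ?_
  rw [← Finset.mul_sum]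
  have hS : ∑ i' : Site (F.P n) 0 × (Fin 2 × Fin 2), Real.exp (-((μ' - δ) * (Site.tdist (P := F.P K) (siteShift (sites_eq F n K h) i.1) (siteShift (sites_eq F n K h) i'.1) : ℝ)))
      ≤ 4 * (2 * (1 + 1 / (μ' - δ))) ^ 3 := by
    rw [Finset.sum_congr rfl fun i' _ => by rw [tdist_coarse_comm F]]
    exact sum_exp_neg_mul_dc_spike_le F h (sub_pos.mpr hδμ) i
  have hA' : 0 ≤ CN * A * Real.exp (-(δ * (Site.tdist (P := F.P K) (siteShift (sites_eq F n K h) i.1) z : ℝ))) := by positivity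
  calc (CN * A * Real.exp (-(δ * (Site.tdist (P := F.P K) (siteShift (sites_eq F n K h) i.1) z : ℝ))))
        * ∑ i' : Site (F.P n) 0 × (Fin 2 × Fin 2), Real.exp (-((μ' - δ) * (Site.tdist (P := F.P K) (siteShift (sites_eq F n K h) i.1) (siteShift (sites_eq F n K h) i'.1) : ℝ)))
      ≤ (CN * A * Real.exp (-(δ * (Site.tdist (P := F.P K) (siteShift (sites_eq F n K h) i.1) z : ℝ)))) * (4 * (2 * (1 + 1 / (μ' - δ))) ^ 3) := mul_le_mul_of_nonneg_left hS hA'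
    _ = _ := by ring

include hε₀ hε7 hreg hseq hι hT ha hAG in
/-- ★★ **THE GRAM COEFFICIENTS OF A WEIGHTED FIELD DECAY FROM ITS CENTRE**: `|λ_i(v)| = |Σ_{i′} M⁻¹_{ii′}⟪G(T(b_{i′})), v⟫| ≤ C_N·4(2(1+1∕(μ′−δ)))³·c₀(√c₁)⁻¹C_pt ℓ³(2(1+1∕(κ−δ)))³·V_b·e^{−δ·dc(i, z)}`,
`C_N = (m_B²∕2 − 3ε(μ′)²)⁻¹e^{9μ′}` — B2c ✓`norm_gram_inv_spike_le_exp_neg_tdist` ∘ §2 ∘ §3. [cite: Balaban1985BackgroundPropagators, Thm 3.1 (3.46) p.398, (3.49) p.399; Balaban1988RG2Cluster, (2.7) p.13] -/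
theorem norm_coeff_le_of_weighted {μ' : ℝ} (hμ' : 0 < μ')
    {δ₁ : ℝ} (hδ₁ : 0 ≤ δ₁)
    (hδ : 3 * ((eta F n K)⁻¹) ^ 2 * (Real.exp (μ' * eta F n K) - 1) ^ 2 + a * ((25 / 8) * (c₁ * ((((F.P K).L : ℝ) ^ (F.P K).d) ^ (K - n))⁻¹ / c₀)) * (Real.exp (3 * μ') - 1) ^ 2 ≤ δ₁ ^ 2)
    (hwin : Real.sqrt (max 2 (16 * c₀ * ((F.L : ℝ) ^ (K - n)) ^ 3 / (a * c₁))) * δ₁ ≤ 1 / 10)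
    {CT : ℝ} (hCT : 0 ≤ CT) (hCTb : ∀ l : SiteL2K ℂ 3 (periodsT3 F K) c₀ W₂, ‖ι (Q'' l)‖ ≤ CT * ‖l‖)
    {CG : ℝ} (hCG : 0 ≤ CG) (hGn : ∀ f, ‖G f‖ ≤ CG * ‖f‖)
    {mB : ℝ} (hmB : 0 < mB) (hcoer : ∀ f : SiteL2K ℂ 3 (periodsT3 F n) c₁ W₂, mB * ‖f‖ ≤ ‖G (T f)‖)
    (hgap : 3 * ((Real.sqrt (max 2 (16 * c₀ * ((F.L : ℝ) ^ (K - n)) ^ 3 / (a * c₁))) * (2 + Real.sqrt (max 2 (16 * c₀ * ((F.L : ℝ) ^ (K - n)) ^ 3 / (a * c₁)))))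
          * (Real.sqrt 3 * (eta F n K)⁻¹ * (Real.exp (μ' * eta F n K) - 1) + (Real.sqrt 3 * (eta F n K)⁻¹ * (Real.exp (μ' * eta F n K) - 1)) ^ 2 + Real.sqrt a * CT * (Real.exp (3 * μ') - 1) + a * CT ^ 2 * (Real.exp (3 * μ') - 1) ^ 2)
          * (8 * Real.sqrt (max 2 (16 * c₀ * ((F.L : ℝ) ^ (K - n)) ^ 3 / (a * c₁))) + 8 * Real.sqrt (max 2 (16 * c₀ * ((F.L : ℝ) ^ (K - n)) ^ 3 / (a * c₁))) ^ 2)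
          * (CT * (1 + (Real.exp (3 * μ') - 1))) + CG * (CT * (Real.exp (3 * μ') - 1))) ^ 2 < mB ^ 2 / 2)
    {Cpt κ : ℝ} (hCpt : 0 ≤ Cpt)
    (hcol : ∀ (y : Site (F.P K) (K - n)) (Y : Matrix (Fin 2) (Fin 2) ℂ) (x : Site (F.P K) 0),
      ‖WL2.equiv ℂ _ W₂ (G (T (ι (Pi.single y Y)))) (siteEquiv F K x)‖ ≤ Cpt * Real.exp (-(κ * (Site.tdist (P := F.P K) (iterBlockOf (K - n) x) y : ℝ))) * ‖Y‖)
    {δ : ℝ} (hδ0 : 0 ≤ δ) (hδκ : δ < κ) (hδμ : δ < μ')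
    (v : SiteL2K ℂ 3 (periodsT3 F K) c₀ W₂) (z : Site (F.P K) (K - n)) {Vb : ℝ}
    (hv : ∀ x : Site (F.P K) 0, ‖WL2.equiv ℂ _ W₂ v (siteEquiv F K x)‖ ≤ Vb * Real.exp (-(δ * (Site.tdist (P := F.P K) (iterBlockOf (K - n) x) z : ℝ))))
    (i : Site (F.P n) 0 × (Fin 2 × Fin 2)) :
    ‖(∑ i', (Matrix.of fun i i' : Site (F.P n) 0 × (Fin 2 × Fin 2) => ⟪G (T ((OrthonormalBasis.mk (orthonormal_spike F) (top_le_span_spike F) : OrthonormalBasis (Site (F.P n) 0 × (Fin 2 × Fin 2)) ℂ (SiteL2K ℂ 3 (periodsT3 F n) c₁ W₂)) i)), G (T ((OrthonormalBasis.mk (orthonormal_spike F) (top_le_span_spike F) : OrthonormalBasis (Site (F.P n) 0 × (Fin 2 × Fin 2)) ℂ (SiteL2K ℂ 3 (periodsT3 F n) c₁ W₂)) i'))⟫_ℂ)⁻¹ i i' * ⟪G (T ((OrthonormalBasis.mk (orthonormal_spike F) (top_le_span_spike F) : OrthonormalBasis (Site (F.P n) 0 × (Fin 2 × Fin 2)) ℂ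 (SiteL2K ℂ 3 (periodsT3 F n) c₁ W₂)) i')), v⟫_ℂ)‖
      ≤ (((mB ^ 2 / 2 - 3 * ((Real.sqrt (max 2 (16 * c₀ * ((F.L : ℝ) ^ (K - n)) ^ 3 / (a * c₁))) * (2 + Real.sqrt (max 2 (16 * c₀ * ((F.L : ℝ) ^ (K - n)) ^ 3 / (a * c₁)))))
          * (Real.sqrt 3 * (eta F n K)⁻¹ * (Real.exp (μ' * eta F n K) - 1) + (Real.sqrt 3 * (eta F n K)⁻¹ * (Real.exp (μ' * eta F n K) - 1)) ^ 2 + Real.sqrt a * CT * (Real.exp (3 * μ') - 1) + a * CT ^ 2 * (Real.exp (3 * μ') - 1) ^ 2)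
          * (8 * Real.sqrt (max 2 (16 * c₀ * ((F.L : ℝ) ^ (K - n)) ^ 3 / (a * c₁))) + 8 * Real.sqrt (max 2 (16 * c₀ * ((F.L : ℝ) ^ (K - n)) ^ 3 / (a * c₁))) ^ 2)
          * (CT * (1 + (Real.exp (3 * μ') - 1))) + CG * (CT * (Real.exp (3 * μ') - 1))) ^ 2)⁻¹ * Real.exp (9 * μ'))
          * (c₀ * (Real.sqrt c₁)⁻¹ * Cpt * (((((F.P K).L : ℝ) ^ (F.P K).d) ^ (K - n)) * (2 * (1 + 1 / (κ - δ))) ^ 3) * Vb) * (4 * (2 * (1 + 1 / (μ' - δ))) ^ 3))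
        * Real.exp (-(δ * (Site.tdist (P := F.P K) (siteShift (sites_eq F n K h) i.1) z : ℝ))) := by
  classical
  have hVb : 0 ≤ Vb := (mul_nonneg_iff_of_pos_right (Real.exp_pos _)).mp ((norm_nonneg _).trans (hv 0))
  have hCN0 : 0 ≤ ((mB ^ 2 / 2 - 3 * ((Real.sqrt (max 2 (16 * c₀ * ((F.L : ℝ) ^ (K - n)) ^ 3 / (a * c₁))) * (2 + Real.sqrt (max 2 (16 * c₀ * ((F.L : ℝ) ^ (K - n)) ^ 3 / (a * c₁)))))
          * (Real.sqrt 3 * (eta F n K)⁻¹ * (Real.exp (μ' * eta F n K) - 1) + (Real.sqrt 3 * (eta F n K)⁻¹ * (Real.exp (μ' * eta F n K) - 1)) ^ 2 + Real.sqrt a * CT * (Real.exp (3 * μ') - 1) + a * CT ^ 2 * (Real.exp (3 * μ') - 1) ^ 2)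
          * (8 * Real.sqrt (max 2 (16 * c₀ * ((F.L : ℝ) ^ (K - n)) ^ 3 / (a * c₁))) + 8 * Real.sqrt (max 2 (16 * c₀ * ((F.L : ℝ) ^ (K - n)) ^ 3 / (a * c₁))) ^ 2)
          * (CT * (1 + (Real.exp (3 * μ') - 1))) + CG * (CT * (Real.exp (3 * μ') - 1))) ^ 2)⁻¹ * Real.exp (9 * μ')) := mul_nonneg (inv_pos.2 (sub_pos.2 hgap)).le (Real.exp_pos _).le
  have hc₀ : 0 < c₀ := Fact.out
  have hA0 : 0 ≤ c₀ * (Real.sqrt c₁)⁻¹ * Cpt * (((((F.P K).L : ℝ) ^ (F.P K).d) ^ (K - n)) * (2 * (1 + 1 / (κ - δ))) ^ 3) * Vb := by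
    have := (F.P K).L_pos
    have hκδ : 0 < κ - δ := sub_pos.mpr hδκ
    positivity
  have hN := fun i₀ i' => norm_gram_inv_spike_le_exp_neg_tdist F h hε₀ hε7 U₀ hreg Q'' hseq ι hι T hT ha G hAG hμ'.le hδ₁ hδ hwin hCT hCTb hCG hGn hmB hcoer hgap i₀ i'
  have hw := fun i' => norm_inner_spike_column_le_of_weighted F h ι hι T G hCpt hcol hδ0 hδκ i' v z hv
  exact norm_sum_mul_le_of_decay F h _ _ hCN0 hA0 hδ0 hδμ z hN hw i

/-! ## §4 The lift of a coarse coefficient field, block-locally -/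

include hε₀ hε7 hreg hseq hι hT in
/-- ★ **THE LIFT OF A COARSE COEFFICIENT FIELD AT `x` SEES ONLY THE BLOCK OF `x`**: for ANY coefficients whose four values on the block `s₀(x) = σ⁻¹(B x)` satisfy `‖coef (s₀(x), jk)‖ ≤ C` (`0 ≤ C`),
`‖(T(Σ_i coef i • b i))(x)‖_{W₂} ≤ 4·A_T·C` — the spikes of every other block vanish at `x` (✓`spike_column_source_eq_zero_off_block`), each surviving one has size
`≤ A_T = (5∕4)√(2c₁)ℓ⁻³∕c₀·(√(2c₁)(√c₁)⁻¹)` (V2b ✓`norm_equiv_column_source_le`, V5 ✓`norm_spikeEntry_le`).  P3v ✓`norm_equiv_lift_coeffSum_apply_le` is the uniform-bound edition.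
[cite: Balaban1985BackgroundPropagators, (3.16) p.393, (3.21)–(3.25) p.394] -/
theorem norm_equiv_lift_coeffSum_apply_le_local (coef : Site (F.P n) 0 × (Fin 2 × Fin 2) → ℂ) (x : Site (F.P K) 0) {Cc : ℝ} (hCc : 0 ≤ Cc)
    (hcoef : ∀ jk : Fin 2 × Fin 2, ‖coef ((siteShift (sites_eq F n K h)).symm (iterBlockOf (K - n) x), jk)‖ ≤ Cc) :
    ‖WL2.equiv ℂ _ W₂ (T (∑ i, coef i • (OrthonormalBasis.mk (orthonormal_spike F) (top_le_span_spike F) : OrthonormalBasis (Site (F.P n) 0 × (Fin 2 × Fin 2)) ℂ (SiteL2K ℂ 3 (periodsT3 F n) c₁ W₂)) i)) (siteEquiv F K x)‖ ≤ 4 * ((5 / 4) * Real.sqrt (2 * c₁) * ((((F.P K).L : ℝ) ^ (F.P K).d) ^ (K - n))⁻¹ / c₀ * (Real.sqrt (2 * c₁) * (Real.sqrt c₁)⁻¹)) * Cc := by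
  classical
  have hc₀ : 0 < c₀ := Fact.out
  -- push `T` and the evaluation through the sum
  have hsum : WL2.equiv ℂ _ W₂ (T (∑ i, coef i • (OrthonormalBasis.mk (orthonormal_spike F) (top_le_span_spike F) : OrthonormalBasis (Site (F.P n) 0 × (Fin 2 × Fin 2)) ℂ (SiteL2K ℂ 3 (periodsT3 F n) c₁ W₂)) i)) (siteEquiv F K x)
      = ∑ i, coef i • WL2.equiv ℂ _ W₂ (T ((OrthonormalBasis.mk (orthonormal_spike F) (top_le_span_spike F) : OrthonormalBasis (Site (F.P n) 0 × (Fin 2 × Fin 2)) ℂ (SiteL2K ℂ 3 (periodsT3 F n) c₁ W₂)) i)) (siteEquiv F K x) := by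
    have e := congrFun (map_sum (WL2.linearEquiv ℂ ℂ (fun _ : TSite 3 (periodsT3 F K) => c₀) (V := W₂))
      (fun i => T (coef i • (OrthonormalBasis.mk (orthonormal_spike F) (top_le_span_spike F) : OrthonormalBasis (Site (F.P n) 0 × (Fin 2 × Fin 2)) ℂ (SiteL2K ℂ 3 (periodsT3 F n) c₁ W₂)) i)) Finset.univ) (siteEquiv F K x)
    simp only [WL2.linearEquiv_apply, Finset.sum_apply, map_smul, Pi.smul_apply] at e
    rw [map_sum]
    simpa only [map_smul] using e
  rw [hsum]
  -- only the block of `x` contributes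
  set s₀ : Site (F.P n) 0 := (siteShift (sites_eq F n K h)).symm (iterBlockOf (K - n) x) with hs₀
  have hoff : ∀ i : Site (F.P n) 0 × (Fin 2 × Fin 2), i.1 ≠ s₀ → WL2.equiv ℂ _ W₂ (T ((OrthonormalBasis.mk (orthonormal_spike F) (top_le_span_spike F) : OrthonormalBasis (Site (F.P n) 0 × (Fin 2 × Fin 2)) ℂ (SiteL2K ℂ 3 (periodsT3 F n) c₁ W₂)) i)) (siteEquiv F K x) = 0 := by
    intro i hi
    have hx : iterBlockOf (K - n) x ≠ siteShift (sites_eq F n K h) i.1 := by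
      intro hcontra
      apply hi
      rw [hs₀]
      exact ((Equiv.symm_apply_eq _).2 hcontra).symm
    have h0 := spike_column_source_eq_zero_off_block F h U₀ Q'' hseq ι hι T hT i x hx
    rw [toL2S_symm_apply] at h0
    rw [← (frobEquiv).symm_apply_apply (WL2.equiv ℂ _ W₂ (T ((OrthonormalBasis.mk (orthonormal_spike F) (top_le_span_spike F) : OrthonormalBasis (Site (F.P n) 0 × (Fin 2 × Fin 2)) ℂ (SiteL2K ℂ 3 (periodsT3 F n) c₁ W₂)) i)) (siteEquiv F K x)), h0, map_zero]
  rw [Fintype.sum_prod_type, Finset.sum_eq_single s₀]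
  rotate_left
  · intro s _ hs
    exact Finset.sum_eq_zero fun jk _ => by rw [hoff (s, jk) hs, smul_zero]
  · intro hs; exact absurd (Finset.mem_univ _) hs
  -- the four surviving terms
  refine (norm_sum_le _ _).trans ?_
  have hterm : ∀ jk : Fin 2 × Fin 2, ‖coef (s₀, jk) • WL2.equiv ℂ _ W₂ (T ((OrthonormalBasis.mk (orthonormal_spike F) (top_le_span_spike F) : OrthonormalBasis (Site (F.P n) 0 × (Fin 2 × Fin 2)) ℂ (SiteL2K ℂ 3 (periodsT3 F n) c₁ W₂)) (s₀, jk))) (siteEquiv F K x)‖ ≤ Cc * ((5 / 4) * Real.sqrt (2 * c₁) * ((((F.P K).L : ℝ) ^ (F.P K).d) ^ (K - n))⁻¹ / c₀ * (Real.sqrt (2 * c₁) * (Real.sqrt c₁)⁻¹)) := by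
    intro jk
    rw [norm_smul]
    refine mul_le_mul (hcoef jk) ?_ (norm_nonneg _) hCc
    rw [spike_eq_lift F h ι hι (s₀, jk)]
    refine (norm_equiv_column_source_le F h hε₀ hε7 U₀ hreg Q'' hseq ι hι T hT _ _ _).trans ?_
    have hY := norm_spikeEntry_le (c₁ := c₁) jk.1 jk.2
    have hA0 : 0 ≤ (5 / 4) * Real.sqrt (2 * c₁) * ((((F.P K).L : ℝ) ^ (F.P K).d) ^ (K - n))⁻¹ / c₀ := by have := (F.P K).L_pos; positivity
    have h2 : 0 ≤ Real.sqrt (2 * c₁) := Real.sqrt_nonneg _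
    exact mul_le_mul_of_nonneg_left (mul_le_mul_of_nonneg_left hY h2) hA0
  calc ∑ jk : Fin 2 × Fin 2, ‖coef (s₀, jk) • WL2.equiv ℂ _ W₂ (T ((OrthonormalBasis.mk (orthonormal_spike F) (top_le_span_spike F) : OrthonormalBasis (Site (F.P n) 0 × (Fin 2 × Fin 2)) ℂ (SiteL2K ℂ 3 (periodsT3 F n) c₁ W₂)) (s₀, jk))) (siteEquiv F K x)‖
      ≤ ∑ _jk : Fin 2 × Fin 2, Cc * ((5 / 4) * Real.sqrt (2 * c₁) * ((((F.P K).L : ℝ) ^ (F.P K).d) ^ (K - n))⁻¹ / c₀ * (Real.sqrt (2 * c₁) * (Real.sqrt c₁)⁻¹)) := Finset.sum_le_sum fun jk _ => hterm jk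
    _ = 4 * ((5 / 4) * Real.sqrt (2 * c₁) * ((((F.P K).L : ℝ) ^ (F.P K).d) ^ (K - n))⁻¹ / c₀ * (Real.sqrt (2 * c₁) * (Real.sqrt c₁)⁻¹)) * Cc := by
        rw [Finset.sum_const, Finset.card_univ, Fintype.card_prod, Fintype.card_fin, nsmul_eq_mul]
        push_cast
        ring

/-! ## §5 ★★★ (src-κ): the source of `(1 − R)v` preserves a block-distance weight -/

include hε₀ hε7 hreg hseq hι hT ha hAG in
/-- ★★★ **(src-κ) — THE SOURCE OF PRINT'S COMPLEMENTARY PROJECTOR PRESERVES A BLOCK-DISTANCE WEIGHT, K-FREE**: with `c(v) = Σ_i λ_i(v)•b_i` (`(1 − R)v = G_a(T c(v))`, ✓P3v §1), for a site field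
`v` with `‖v(x)‖ ≤ V_b·e^{−δ·tdist(B x, z)}` (`0 ≤ δ < min(κ, μ′)`), at every fine site
`‖(T c(v))(x)‖_{W₂} ≤ (4·A_T·C_N·c₀(√c₁)⁻¹C_pt ℓ³(2(1+1∕(κ−δ)))³·4(2(1+1∕(μ′−δ)))³)·V_b·e^{−δ·tdist(B x, z)}` — §4 at the block of `x` ∘ §3 (whose weight at `σ(s₀(x)) = B x` is the wanted one);
`A_T·c₀(√c₁)⁻¹ℓ³ = 5∕2`, so the constant is K-free for every `c₁`.  The `δ = 0` case is ✓P3v `norm_equiv_complementary_source_apply_le`.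
[cite: Balaban1985BackgroundPropagators, Thm 3.1 (3.42)∕(3.46) pp.397–398, (3.49) p.399; Balaban1985Variational, (139) p.299; Balaban1988RG2Cluster, (2.7) p.13] -/
theorem norm_equiv_complementary_source_apply_le_of_weighted {μ' : ℝ} (hμ' : 0 < μ')
    {δ₁ : ℝ} (hδ₁ : 0 ≤ δ₁)
    (hδ : 3 * ((eta F n K)⁻¹) ^ 2 * (Real.exp (μ' * eta F n K) - 1) ^ 2 + a * ((25 / 8) * (c₁ * ((((F.P K).L : ℝ) ^ (F.P K).d) ^ (K - n))⁻¹ / c₀)) * (Real.exp (3 * μ') - 1) ^ 2 ≤ δ₁ ^ 2)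
    (hwin : Real.sqrt (max 2 (16 * c₀ * ((F.L : ℝ) ^ (K - n)) ^ 3 / (a * c₁))) * δ₁ ≤ 1 / 10)
    {CT : ℝ} (hCT : 0 ≤ CT) (hCTb : ∀ l : SiteL2K ℂ 3 (periodsT3 F K) c₀ W₂, ‖ι (Q'' l)‖ ≤ CT * ‖l‖)
    {CG : ℝ} (hCG : 0 ≤ CG) (hGn : ∀ f, ‖G f‖ ≤ CG * ‖f‖)
    {mB : ℝ} (hmB : 0 < mB) (hcoer : ∀ f : SiteL2K ℂ 3 (periodsT3 F n) c₁ W₂, mB * ‖f‖ ≤ ‖G (T f)‖)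
    (hgap : 3 * ((Real.sqrt (max 2 (16 * c₀ * ((F.L : ℝ) ^ (K - n)) ^ 3 / (a * c₁))) * (2 + Real.sqrt (max 2 (16 * c₀ * ((F.L : ℝ) ^ (K - n)) ^ 3 / (a * c₁)))))
          * (Real.sqrt 3 * (eta F n K)⁻¹ * (Real.exp (μ' * eta F n K) - 1) + (Real.sqrt 3 * (eta F n K)⁻¹ * (Real.exp (μ' * eta F n K) - 1)) ^ 2 + Real.sqrt a * CT * (Real.exp (3 * μ') - 1) + a * CT ^ 2 * (Real.exp (3 * μ') - 1) ^ 2)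
          * (8 * Real.sqrt (max 2 (16 * c₀ * ((F.L : ℝ) ^ (K - n)) ^ 3 / (a * c₁))) + 8 * Real.sqrt (max 2 (16 * c₀ * ((F.L : ℝ) ^ (K - n)) ^ 3 / (a * c₁))) ^ 2)
          * (CT * (1 + (Real.exp (3 * μ') - 1))) + CG * (CT * (Real.exp (3 * μ') - 1))) ^ 2 < mB ^ 2 / 2)
    {Cpt κ : ℝ} (hCpt : 0 ≤ Cpt)
    (hcol : ∀ (y : Site (F.P K) (K - n)) (Y : Matrix (Fin 2) (Fin 2) ℂ) (x : Site (F.P K) 0),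
      ‖WL2.equiv ℂ _ W₂ (G (T (ι (Pi.single y Y)))) (siteEquiv F K x)‖ ≤ Cpt * Real.exp (-(κ * (Site.tdist (P := F.P K) (iterBlockOf (K - n) x) y : ℝ))) * ‖Y‖)
    {δ : ℝ} (hδ0 : 0 ≤ δ) (hδκ : δ < κ) (hδμ : δ < μ')
    (v : SiteL2K ℂ 3 (periodsT3 F K) c₀ W₂) (z : Site (F.P K) (K - n)) {Vb : ℝ}
    (hv : ∀ x : Site (F.P K) 0, ‖WL2.equiv ℂ _ W₂ v (siteEquiv F K x)‖ ≤ Vb * Real.exp (-(δ * (Site.tdist (P := F.P K) (iterBlockOf (K - n) x) z : ℝ)))) (x : Site (F.P K) 0) :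
    ‖WL2.equiv ℂ _ W₂ (T (∑ i, (∑ i', (Matrix.of fun i i' : Site (F.P n) 0 × (Fin 2 × Fin 2) => ⟪G (T ((OrthonormalBasis.mk (orthonormal_spike F) (top_le_span_spike F) : OrthonormalBasis (Site (F.P n) 0 × (Fin 2 × Fin 2)) ℂ (SiteL2K ℂ 3 (periodsT3 F n) c₁ W₂)) i)), G (T ((OrthonormalBasis.mk (orthonormal_spike F) (top_le_span_spike F) : OrthonormalBasis (Site (F.P n) 0 × (Fin 2 × Fin 2)) ℂ (SiteL2K ℂ 3 (periodsT3 F n) c₁ W₂)) i'))⟫_ℂ)⁻¹ i i' * ⟪G (T ((OrthonormalBasis.mk (orthonormal_spike F) (top_le_span_spike F) : OrthonormalBasis (Site (F.P n) 0 × (Fin 2 × Fin 2)) ℂ (SiteL2K ℂ 3 (periodsT3 F n) c₁ W₂)) i')), v⟫_ℂ) • (OrthonormalBasis.mk (orthonormal_spike F) (top_le_span_spike F) : OrthonormalBasis (Site (F.P n) 0 × (Fin 2 × Fin 2)) ℂ (SiteL2K ℂ 3 (periodsT3 F n) c₁ W₂)) i)) (siteEquiv F K x)‖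
      ≤ (4 * ((5 / 4) * Real.sqrt (2 * c₁) * ((((F.P K).L : ℝ) ^ (F.P K).d) ^ (K - n))⁻¹ / c₀ * (Real.sqrt (2 * c₁) * (Real.sqrt c₁)⁻¹))
          * ((((mB ^ 2 / 2 - 3 * ((Real.sqrt (max 2 (16 * c₀ * ((F.L : ℝ) ^ (K - n)) ^ 3 / (a * c₁))) * (2 + Real.sqrt (max 2 (16 * c₀ * ((F.L : ℝ) ^ (K - n)) ^ 3 / (a * c₁)))))
          * (Real.sqrt 3 * (eta F n K)⁻¹ * (Real.exp (μ' * eta F n K) - 1) + (Real.sqrt 3 * (eta F n K)⁻¹ * (Real.exp (μ' * eta F n K) - 1)) ^ 2 + Real.sqrt a * CT * (Real.exp (3 * μ') - 1) + a * CT ^ 2 * (Real.exp (3 * μ') - 1) ^ 2)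
          * (8 * Real.sqrt (max 2 (16 * c₀ * ((F.L : ℝ) ^ (K - n)) ^ 3 / (a * c₁))) + 8 * Real.sqrt (max 2 (16 * c₀ * ((F.L : ℝ) ^ (K - n)) ^ 3 / (a * c₁))) ^ 2)
          * (CT * (1 + (Real.exp (3 * μ') - 1))) + CG * (CT * (Real.exp (3 * μ') - 1))) ^ 2)⁻¹ * Real.exp (9 * μ'))
          * (c₀ * (Real.sqrt c₁)⁻¹ * Cpt * (((((F.P K).L : ℝ) ^ (F.P K).d) ^ (K - n)) * (2 * (1 + 1 / (κ - δ))) ^ 3)) * (4 * (2 * (1 + 1 / (μ' - δ))) ^ 3))))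
        * Vb * Real.exp (-(δ * (Site.tdist (P := F.P K) (iterBlockOf (K - n) x) z : ℝ))) := by
  classical
  have hVb : 0 ≤ Vb := (mul_nonneg_iff_of_pos_right (Real.exp_pos _)).mp ((norm_nonneg _).trans (hv 0))
  have hCN0 : 0 ≤ ((mB ^ 2 / 2 - 3 * ((Real.sqrt (max 2 (16 * c₀ * ((F.L : ℝ) ^ (K - n)) ^ 3 / (a * c₁))) * (2 + Real.sqrt (max 2 (16 * c₀ * ((F.L : ℝ) ^ (K - n)) ^ 3 / (a * c₁)))))
          * (Real.sqrt 3 * (eta F n K)⁻¹ * (Real.exp (μ' * eta F n K) - 1) + (Real.sqrt 3 * (eta F n K)⁻¹ * (Real.exp (μ' * eta F n K) - 1)) ^ 2 + Real.sqrt a * CT * (Real.exp (3 * μ') - 1) + a * CT ^ 2 * (Real.exp (3 * μ') - 1) ^ 2)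
          * (8 * Real.sqrt (max 2 (16 * c₀ * ((F.L : ℝ) ^ (K - n)) ^ 3 / (a * c₁))) + 8 * Real.sqrt (max 2 (16 * c₀ * ((F.L : ℝ) ^ (K - n)) ^ 3 / (a * c₁))) ^ 2)
          * (CT * (1 + (Real.exp (3 * μ') - 1))) + CG * (CT * (Real.exp (3 * μ') - 1))) ^ 2)⁻¹ * Real.exp (9 * μ')) := mul_nonneg (inv_pos.2 (sub_pos.2 hgap)).le (Real.exp_pos _).le
  have hc₀ : 0 < c₀ := Fact.out
  have hA0 : 0 ≤ c₀ * (Real.sqrt c₁)⁻¹ * Cpt * (((((F.P K).L : ℝ) ^ (F.P K).d) ^ (K - n)) * (2 * (1 + 1 / (κ - δ))) ^ 3) * Vb := by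
    have := (F.P K).L_pos
    have hκδ : 0 < κ - δ := sub_pos.mpr hδκ
    positivity
  have hS0 : 0 ≤ 4 * (2 * (1 + 1 / (μ' - δ))) ^ 3 := by
    have hμδ : 0 < μ' - δ := sub_pos.mpr hδμ
    positivity
  -- the coefficients of the block of `x` carry the weight `e^{−δ·tdist(B x, z)}`
  have hσ : siteShift (sites_eq F n K h) ((siteShift (sites_eq F n K h)).symm (iterBlockOf (K - n) x)) = iterBlockOf (K - n) x := Equiv.apply_symm_apply _ _
  have hcoef := fun jk : Fin 2 × Fin 2 =>
    norm_coeff_le_of_weighted F h hε₀ hε7 U₀ hreg Q'' hseq ι hι T hT ha G hAG hμ' hδ₁ hδ hwin hCT hCTb hCG hGn hmB hcoer hgap hCpt hcol hδ0 hδκ hδμ v z hv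
      ((siteShift (sites_eq F n K h)).symm (iterBlockOf (K - n) x), jk)
  simp only [hσ] at hcoef
  refine (norm_equiv_lift_coeffSum_apply_le_local F h hε₀ hε7 U₀ hreg Q'' hseq ι hι T hT _ x
    (mul_nonneg (mul_nonneg (mul_nonneg hCN0 hA0) hS0) (Real.exp_pos _).le) hcoef).trans (le_of_eq ?_)
  ring

include hε₀ hε7 hreg hseq hι hT ha hAG in
/-- ★★★ **(src-κ) AS THE LETTER `hsrcW` OF THE (c4w) KNIT** (W4's fibre currency; P4 ✓`gradient_row_of_letters`' `hsrc` is the `δ = 0` shape):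
`∀ v z V_b, (∀ x, ‖v(x)‖ ≤ V_b·e^{−δ·tdist(B x, z)}) → ∀ x, ‖(T c(v))(x)‖ ≤ C_src,w·V_b·e^{−δ·tdist(B x, z)}`, `C_src,w` as in `norm_equiv_complementary_source_apply_le_of_weighted`.
[cite: Balaban1985BackgroundPropagators, Thm 3.1 (3.42)∕(3.46) pp.397–398, (3.49) p.399; Balaban1985Variational, (139) p.299] -/
theorem hsrcW_of_P3v {μ' : ℝ} (hμ' : 0 < μ')
    {δ₁ : ℝ} (hδ₁ : 0 ≤ δ₁)
    (hδ : 3 * ((eta F n K)⁻¹) ^ 2 * (Real.exp (μ' * eta F n K) - 1) ^ 2 + a * ((25 / 8) * (c₁ * ((((F.P K).L : ℝ) ^ (F.P K).d) ^ (K - n))⁻¹ / c₀)) * (Real.exp (3 * μ') - 1) ^ 2 ≤ δ₁ ^ 2)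
    (hwin : Real.sqrt (max 2 (16 * c₀ * ((F.L : ℝ) ^ (K - n)) ^ 3 / (a * c₁))) * δ₁ ≤ 1 / 10)
    {CT : ℝ} (hCT : 0 ≤ CT) (hCTb : ∀ l : SiteL2K ℂ 3 (periodsT3 F K) c₀ W₂, ‖ι (Q'' l)‖ ≤ CT * ‖l‖)
    {CG : ℝ} (hCG : 0 ≤ CG) (hGn : ∀ f, ‖G f‖ ≤ CG * ‖f‖)
    {mB : ℝ} (hmB : 0 < mB) (hcoer : ∀ f : SiteL2K ℂ 3 (periodsT3 F n) c₁ W₂, mB * ‖f‖ ≤ ‖G (T f)‖)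
    (hgap : 3 * ((Real.sqrt (max 2 (16 * c₀ * ((F.L : ℝ) ^ (K - n)) ^ 3 / (a * c₁))) * (2 + Real.sqrt (max 2 (16 * c₀ * ((F.L : ℝ) ^ (K - n)) ^ 3 / (a * c₁)))))
          * (Real.sqrt 3 * (eta F n K)⁻¹ * (Real.exp (μ' * eta F n K) - 1) + (Real.sqrt 3 * (eta F n K)⁻¹ * (Real.exp (μ' * eta F n K) - 1)) ^ 2 + Real.sqrt a * CT * (Real.exp (3 * μ') - 1) + a * CT ^ 2 * (Real.exp (3 * μ') - 1) ^ 2)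
          * (8 * Real.sqrt (max 2 (16 * c₀ * ((F.L : ℝ) ^ (K - n)) ^ 3 / (a * c₁))) + 8 * Real.sqrt (max 2 (16 * c₀ * ((F.L : ℝ) ^ (K - n)) ^ 3 / (a * c₁))) ^ 2)
          * (CT * (1 + (Real.exp (3 * μ') - 1))) + CG * (CT * (Real.exp (3 * μ') - 1))) ^ 2 < mB ^ 2 / 2)
    {Cpt κ : ℝ} (hCpt : 0 ≤ Cpt)
    (hcol : ∀ (y : Site (F.P K) (K - n)) (Y : Matrix (Fin 2) (Fin 2) ℂ) (x : Site (F.P K) 0),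
      ‖WL2.equiv ℂ _ W₂ (G (T (ι (Pi.single y Y)))) (siteEquiv F K x)‖ ≤ Cpt * Real.exp (-(κ * (Site.tdist (P := F.P K) (iterBlockOf (K - n) x) y : ℝ))) * ‖Y‖)
    {δ : ℝ} (hδ0 : 0 ≤ δ) (hδκ : δ < κ) (hδμ : δ < μ') :
    ∀ (v : SiteL2K ℂ 3 (periodsT3 F K) c₀ W₂) (z : Site (F.P K) (K - n)) (Vb : ℝ),
      (∀ x : Site (F.P K) 0, ‖WL2.equiv ℂ _ W₂ v (siteEquiv F K x)‖ ≤ Vb * Real.exp (-(δ * (Site.tdist (P := F.P K) (iterBlockOf (K - n) x) z : ℝ)))) →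
      ∀ x : Site (F.P K) 0,
        ‖WL2.equiv ℂ _ W₂ (T ((fun v => ∑ i, (∑ i', (Matrix.of fun i i' : Site (F.P n) 0 × (Fin 2 × Fin 2) => ⟪G (T ((OrthonormalBasis.mk (orthonormal_spike F) (top_le_span_spike F) : OrthonormalBasis (Site (F.P n) 0 × (Fin 2 × Fin 2)) ℂ (SiteL2K ℂ 3 (periodsT3 F n) c₁ W₂)) i)), G (T ((OrthonormalBasis.mk (orthonormal_spike F) (top_le_span_spike F) : OrthonormalBasis (Site (F.P n) 0 × (Fin 2 × Fin 2)) ℂ (SiteL2K ℂ 3 (periodsT3 F n) c₁ W₂)) i'))⟫_ℂ)⁻¹ i i' * ⟪G (T ((OrthonormalBasis.mk (orthonormal_spike F) (top_le_span_spike F) : OrthonormalBasis (Site (F.P n) 0 × (Fin 2 × Fin 2)) ℂ (SiteL2K ℂ 3 (periodsT3 F n) c₁ W₂)) i')), v⟫_ℂ) • (OrthonormalBasis.mk (orthonormal_spike F) (top_le_span_spike F) : OrthonormalBasis (Site (F.P n) 0 × (Fin 2 × Fin 2)) ℂ (SiteL2K ℂ 3 (periodsT3 F n) c₁ W₂)) i)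 v)) (siteEquiv F K x)‖
          ≤ (4 * ((5 / 4) * Real.sqrt (2 * c₁) * ((((F.P K).L : ℝ) ^ (F.P K).d) ^ (K - n))⁻¹ / c₀ * (Real.sqrt (2 * c₁) * (Real.sqrt c₁)⁻¹))
              * ((((mB ^ 2 / 2 - 3 * ((Real.sqrt (max 2 (16 * c₀ * ((F.L : ℝ) ^ (K - n)) ^ 3 / (a * c₁))) * (2 + Real.sqrt (max 2 (16 * c₀ * ((F.L : ℝ) ^ (K - n)) ^ 3 / (a * c₁)))))
              * (Real.sqrt 3 * (eta F n K)⁻¹ * (Real.exp (μ' * eta F n K) - 1) + (Real.sqrt 3 * (eta F n K)⁻¹ * (Real.exp (μ' * eta F n K) - 1)) ^ 2 + Real.sqrt a * CT * (Real.exp (3 * μ') - 1) + a * CT ^ 2 * (Real.exp (3 * μ') - 1) ^ 2)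
              * (8 * Real.sqrt (max 2 (16 * c₀ * ((F.L : ℝ) ^ (K - n)) ^ 3 / (a * c₁))) + 8 * Real.sqrt (max 2 (16 * c₀ * ((F.L : ℝ) ^ (K - n)) ^ 3 / (a * c₁))) ^ 2)
              * (CT * (1 + (Real.exp (3 * μ') - 1))) + CG * (CT * (Real.exp (3 * μ') - 1))) ^ 2)⁻¹ * Real.exp (9 * μ'))
              * (c₀ * (Real.sqrt c₁)⁻¹ * Cpt * (((((F.P K).L : ℝ) ^ (F.P K).d) ^ (K - n)) * (2 * (1 + 1 / (κ - δ))) ^ 3)) * (4 * (2 * (1 + 1 / (μ' - δ))) ^ 3))))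
            * Vb * Real.exp (-(δ * (Site.tdist (P := F.P K) (iterBlockOf (K - n) x) z : ℝ))) :=
  fun v z _ hv x => norm_equiv_complementary_source_apply_le_of_weighted F h hε₀ hε7 U₀ hreg Q'' hseq ι hι T hT ha G hAG hμ' hδ₁ hδ hwin hCT hCTb hCG hGn hmB hcoer hgap hCpt hcol
    hδ0 hδκ hδμ v z hv x

end Summit.QuantumFields.YangMills.Theorems.Prop7ComplementarySourceWeighted

end
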